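import Summits.ResolutionOfSingularities.ResolutionOfSingularities.Theorems.StallVertexWalk
import Summits.ResolutionOfSingularities.ResolutionOfSingularities.Theorems.StallVertexRigid
import HarnessLib

/-!
# StallVertexLines — decomp-res node «StallVertex» (lens-5 g20 rev 2), tree file 7/9 of the node

Content VERBATIM from the decomp-res lens-5 g20 file
`HOME/decomp-res-lens-5/g20/parts/StallVertex-g20-rev2-d6168cb0.lean` (1724 l; rev 2, which SUPERSEDES
the pins 0349e14d (869 l) and rev 1 d60a69dd with all earlier statements byte-identical; HOME =
run/shared/lean/pub/decomp-res).  The rev-0 sections §1/§2/§3/§4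
are ALREADY in the tree from pin 0349e14d as `StallVertexForms` / `StallVertexKernels` / `StallVertexWalk` /
`StallVertexClasses`; this file carries ONLY
declarations NEW in rev 1 / rev 2.  Critic: CRITIC-LEDGER rows 142 (CLEARED 20:41:19Z: the stall vertex law), 142a
(21:01:24Z: rev 1 stall rigidity), 142b
(21:17:44Z: rev 2 contact-line law; ONE located-residual aside = `StallVertex.NoLineFreeRigidSkewStalledTailsDeep`,
the sharpest exact form, chain
skew ↔ vertexBound ↔ rigid ↔ lineFree hypothesis-free, superseding `CoefficientCut.NoSkewJointTailsDeep`).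
Landed by decomp-res writer g7.  Every file of the
node is in the Theses cone (the lens imports the in-cone `DifferentialShade`), so the residual is booked on the
route by RE-LOCATING the existing aside 28122
`CFNoSkewJointTailsDeep` (EXACTLY ⟺ it) — one aside, not two.

§3 additions of rev 1 / rev 2 (l. 1152–1383, `section Walk`): the rigid vertex law on the walk `VertexLawEqAt`,
`vertexLawEqAt_of_stall`, `vertexLawAt_of_vertexLawEqAt`,
`two_le_muP_of_offConeAt`; §3b–§3c the CONTACT LINE: `direction`, `carryLine`, `ContactLineFrom`, the
`carryLine_*` lemmas, `direction_chart` / `direction_of_ne`,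
`exists_ne_chart_carryLine_ne_zero`, `Fin3.exists_third`, THE CONTACT-LINE LAW `planar_of_contactLine` /
`planar_of_contactLine_of_repeats`, `CleanAt`,
`initialForm_succ_of_cleanAt`.  PROVED, 0 sorry.  Imports the landed `StallVertexWalk` and `StallVertexRigid`.

[WRITER NOTE (decomp-res writer g7): file split only; namespace, opens, section variables and every declaration
exactly as in the lens (global `set_option` dropped; the lens's `set_option maxHeartbeats … in` on `stall_rigid` kept).]

(Sources: KawanoueMatsuki2016 Prop. 4 (2), §4.1; Hauser2010; HauserPerlega2024; Moh1987; CossartPiltant2008;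
Giraud1975; Hironaka1964; ZariskiSamuelII Ch. VIII §2.)
-/

noncomputable section

open MvPolynomial Finset
open Literature.AlgebraicGeometry.Resolution
open Literature.AlgebraicGeometry.Resolution.Hauser2010
open Literature.AlgebraicGeometry.Resolution.HauserPerlega2024
open Literature.Barriers.ResolutionOfSingularities
open Literature.AlgebraicGeometry.Resolution.PointBlowup
open Summit.ResolutionOfSingularities.ResolutionOfSingularities.Theses
open Summit.ResolutionOfSingularities.ResolutionOfSingularities.Theorems.TightDefectClasses
open Summit.ResolutionOfSingularities.ResolutionOfSingularities.Theorems.ProximityCut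
open Summit.ResolutionOfSingularities.ResolutionOfSingularities.Theorems.ExitLaw
open Summit.ResolutionOfSingularities.ResolutionOfSingularities.Theorems.DifferentialShade

namespace Summit.ResolutionOfSingularities.ResolutionOfSingularities.Theorems.StallVertex

section Walk

variable {K : Type} [Field K] [DecidableEq K]

variable {q : ℕ} {s₀ : State (Fin 3) K}

/-- **THE RIGID VERTEX LAW AT TIME `t`** (the law WITH EQUALITY, a kernel predicate on the walk): for every
minimising index `J₀` of `μ_P` at `ifp W t` (order `d₀`, level `a₀`), with `n = mult_{direction} in(g₀)`:
(1) `n = d₀ − a₀·lostMass` EXACTLY; (2) `ord₀ g₀(t+1) = (d₀ − a₀) + n` (the layer bound is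
attained); (3) `J₀` is
again a minimiser at `t+1` (PERSISTENCE); (4) `μ_P(t+1) = 2 μ_P(t) − 1 − lostMass`; (5) `μ_{P,D_{j_t}}(t+1) =
μ_P(t) − 1`. -/
def VertexLawEqAt (W : ForcedWalk q s₀) (t : ℕ) : Prop :=
  ∀ J₀ ∈ (ifp W t).idx, (ifp W t).muP q = levelRatio (ordZero ((ifp W t).gen J₀)) (q - J₀.degree) →
    ∀ d₀ : ℕ, ordZero ((ifp W t).gen J₀) = d₀ →
    (((ordZero (dirForm d₀ (W.j t) (W.b t) ((ifp W t).gen J₀))).toNat : ℚ) =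
        (d₀ : ℚ) - (q - J₀.degree : ℕ) * lostMass q (W.j t) (W.b t) (ifp W t)) ∧
    (ordZero ((ifp W (t + 1)).gen J₀) =
        ((d₀ - (q - J₀.degree) + (ordZero (dirForm d₀ (W.j t) (W.b t) ((ifp W t).gen J₀))).toNat : ℕ) : ℕ∞)) ∧
    ((ifp W (t + 1)).muP q = levelRatio (ordZero ((ifp W (t + 1)).gen J₀)) (q - J₀.degree)) ∧
    ((ifp W (t + 1)).muP q =
        (((2 * ((d₀ : ℚ) / (q - J₀.degree : ℕ)) - 1 - lostMass q (W.j t) (W.b t) (ifp W t) : ℚ)) : WithTop ℚ)) ∧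
    ((ifp W (t + 1)).muPD q (W.j t) = ((((d₀ : ℚ) / (q - J₀.degree : ℕ)) - 1 : ℚ) : WithTop ℚ))

/-- **STALL RIGIDITY ALONG ROOT WALKS (hypothesis-free):** at every stalled move of a forced walk from a root the
vertex law holds WITH EQUALITY, the layer bound is attained, every minimiser persists and
`μ_P(t+1) = 2 μ_P(t) − 1 − lostMass(t)`.  (Census, g18 beds: equality 1167/1167, persistence 1096/1096 — now
theorems.) [folklore] -/
theorem vertexLawEqAt_of_stall {p e : ℕ} (hp : p.Prime) [CharP K p] {s₀ : State (Fin 3) K} (hs : IsRoot (p ^ e) s₀)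
    (W : ForcedWalk (p ^ e) s₀) (t : ℕ) (hst : (ifp W t).muTilde (p ^ e) ≤ (ifp W (t + 1)).muTilde (p ^ e)) :
    VertexLawEqAt W t := by
  intro J₀ hJ₀ hμ d₀ hd₀
  have h := stall_rigid (p ^ e) (W.j t) (W.b t) (W.onExc t) (ifp W t)
    (fun J hJ => (level_bounds W t J hJ).2) (sing_ifp hp hs W t) (by rw [← ifp_succ]; exact hst) hJ₀ hμ hd₀
  rw [ifp_succ]
  exact h

/-- The rigid law implies the law. [folklore] -/
theorem vertexLawAt_of_vertexLawEqAt (W : ForcedWalk q s₀) (t : ℕ) (h : VertexLawEqAt W t) : VertexLawAt W t :=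
  fun J₀ hJ₀ hμ d₀ hd₀ => (h J₀ hJ₀ hμ d₀ hd₀).1.ge

/-- **OFF-CONE MOVES NEED `μ_P ≥ 2`** (the thin-cell fact, hypothesis-free at EVERY move, stalled or not): if the
direction avoids the tangent cone of a minimiser `g₀` (`ord₀ dirForm = 0`) then Lemma A gives `ord₀ g₀' ≤
d₀ − a₀`
while `Sing` persists (`ord₀ g₀' ≥ a₀`), so `d₀ ≥ 2a₀`.  Census (g18 beds): 0 off-cone moves at 2494
drop pairs and
1167 stall pairs. [new] [folklore] -/
theorem two_le_muP_of_offConeAt {p e : ℕ} (hp : p.Prime) [CharP K p] {s₀ : State (Fin 3) K} (hs : IsRoot (p ^ e) s₀)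
    (W : ForcedWalk (p ^ e) s₀) (t : ℕ) (h : OffConeAt W t) : ((2 : ℚ) : WithTop ℚ) ≤ (ifp W t).muP (p ^ e) := by
  obtain ⟨J₀, hJ₀, hμ, d₀, hd₀, h0⟩ := h
  have hlev := level_bounds W t J₀ hJ₀
  have hg₀ne : (ifp W t).gen J₀ ≠ 0 := by
    intro h0'
    rw [h0', ordZero_zero] at hd₀
    exact ENat.top_ne_coe _ hd₀
  have had₀ : p ^ e - J₀.degree ≤ d₀ := by
    have := sing_ifp hp hs W t J₀ hJ₀ hg₀ne
    rw [hd₀] at this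
    exact_mod_cast this
  have hA : ordZero ((ifp W (t + 1)).gen J₀) ≤ ((d₀ - (p ^ e - J₀.degree) : ℕ) : ℕ∞) := by
    rw [ifp_succ]
    show ordZero (PointBlowup.translate (W.b t) (chartTransform (p ^ e - J₀.degree) (W.j t) ((ifp W t).gen J₀))) ≤ _
    have h1 := ordZero_move_le_layer (W.b t) (W.onExc t) had₀ hd₀
    rw [h0, add_zero] at h1
    exact h1
  have hg₀'ne : (ifp W (t + 1)).gen J₀ ≠ 0 := by
    intro h0'
    rw [h0', ordZero_zero, top_le_iff] at hA
    exact ENat.coe_ne_top _ hA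
  have hidx : J₀ ∈ (ifp W (t + 1)).idx := by rw [idx_ifp] at hJ₀ ⊢; exact hJ₀
  have hlow : (((p ^ e - J₀.degree : ℕ)) : ℕ∞) ≤ ordZero ((ifp W (t + 1)).gen J₀) :=
    sing_ifp hp hs W (t + 1) J₀ hidx hg₀'ne
  have h2 : p ^ e - J₀.degree ≤ d₀ - (p ^ e - J₀.degree) := by
    have := le_trans hlow hA
    exact_mod_cast this
  have hapos : (0 : ℚ) < (p ^ e - J₀.degree : ℕ) := by exact_mod_cast (by omega : 0 < p ^ e - J₀.degree)
  rw [hμ, hd₀, levelRatio_natCast, WithTop.coe_le_coe, le_div_iff₀ hapos]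
  have h3 : 2 * (p ^ e - J₀.degree) ≤ d₀ := by omega
  exact_mod_cast h3

/-! ### §3b CONTACT LINES (letters only): a carried line through every direction forces a respected coordinate plane -/

/-- The DIRECTION of move `t`: the point `[b ; b_j ↦ 1] ∈ ℙ²` of the tangent directions that is blown up to the
centre of move `t + 1` (`W.b t` with the chart coordinate set to `1`). [folklore: Hauser2010 §F] -/
def direction (W : ForcedWalk q s₀) (t : ℕ) : Fin 3 → K :=
  Function.update (W.b t) (W.j t) 1

/-- **A CARRIED LINE.**  A linear functional `c` on the tangent directions at time `s`, transported along the walk by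
the rule of the strict transform of the plane `{Σ cᵢ uᵢ = 0}` THROUGH the direction: in the chart `u_j` and after the
translation, `Σ_{i ≠ j} cᵢ uᵢ + (Σ cᵢ δᵢ) = Σ_{i ≠ j} cᵢ uᵢ` — the chart coefficient is
ZEROED, the others kept
(valid exactly when the direction lies on the plane, `Σ cᵢ δᵢ = 0`).  `carryLine W s c n` = the coefficients at time
`s + n`. [new object: the explicit polynomial form of Kawanoue–Matsuki's `μ = 1` element of the enlarged LGS] -/
def carryLine (W : ForcedWalk q s₀) (s : ℕ) (c : Fin 3 → K) : ℕ → Fin 3 → K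
  | 0 => c
  | n + 1 => Function.update (carryLine W s c n) (W.j (s + n)) 0

/-- **A CONTACT LINE FROM TIME `s`**: a non-zero linear functional whose carried line contains the direction of EVERY
move from time `s` on — a PLANE OF PERMANENT CONTACT `{Σ cᵢ uᵢ = 0}` whose strict transforms contain all later
centres.  A predicate on the LETTERS `(j_t, b_t)` of the walk only. [new] -/
def ContactLineFrom (W : ForcedWalk q s₀) (s : ℕ) (c : Fin 3 → K) : Prop :=
  c ≠ 0 ∧ ∀ n, ∑ i, carryLine W s c n i * direction W (s + n) i = 0

/-- `carryLine_succ_apply`: Auxiliary step of this node's calculus, VERBATIM from the lens file (see the module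
docstring); the statement is its type. [folklore] -/
theorem carryLine_succ_apply (W : ForcedWalk q s₀) (s : ℕ) (c : Fin 3 → K) (n : ℕ) (i : Fin 3) :
    carryLine W s c (n + 1) i = if i = W.j (s + n) then 0 else carryLine W s c n i := by
  change Function.update (carryLine W s c n) (W.j (s + n)) 0 i = _
  rw [Function.update_apply]

/-- A zeroed coefficient stays zero. [folklore] -/
theorem carryLine_apply_eq_zero_of_le (W : ForcedWalk q s₀) (s : ℕ) (c : Fin 3 → K) {n : ℕ} {i : Fin 3}
    (h : carryLine W s c n i = 0) : ∀ n', n ≤ n' → carryLine W s c n' i = 0 := by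
  intro n' hn'
  induction n' with
  | zero =>
    have : n = 0 := Nat.le_zero.mp hn'
    subst this; exact h
  | succ m ih =>
    rcases Nat.lt_or_eq_of_le hn' with hlt | heq
    · rw [carryLine_succ_apply]
      split_ifs
      · rfl
      · exact ih (Nat.lt_succ_iff.mp hlt)
    · rw [← heq]; exact h

/-- The chart coefficient is zeroed by the move. [folklore] -/
theorem carryLine_chart_eq_zero (W : ForcedWalk q s₀) (s : ℕ) (c : Fin 3 → K) (n : ℕ) :
    carryLine W s c (n + 1) (W.j (s + n)) = 0 := by
  rw [carryLine_succ_apply, if_pos rfl]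

/-- `direction_chart`: Auxiliary step of this node's calculus, VERBATIM from the lens file (see the module
docstring); the statement is its type. [folklore] -/
theorem direction_chart (W : ForcedWalk q s₀) (t : ℕ) : direction W t (W.j t) = 1 := by
  unfold direction; rw [Function.update_self]

/-- `direction_of_ne`: Auxiliary step of this node's calculus, VERBATIM from the lens file (see the module
docstring); the statement is its type. [folklore] -/
theorem direction_of_ne (W : ForcedWalk q s₀) (t : ℕ) {i : Fin 3} (hi : i ≠ W.j t) : direction W t i = W.b t i := by
  unfold direction; rw [Function.update_of_ne hi]

/-- A contact line never dies: at every time some NON-chart coefficient is non-zero (else the contact equation reads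
`c_j · 1 = 0` and the whole functional vanishes). [folklore] -/
theorem exists_ne_chart_carryLine_ne_zero (W : ForcedWalk q s₀) {s : ℕ} {c : Fin 3 → K} (h : ContactLineFrom W s c)
    (n : ℕ) : ∃ i, i ≠ W.j (s + n) ∧ carryLine W s c n i ≠ 0 := by
  induction n with
  | zero =>
    by_contra hne
    push Not at hne
    have hsum := h.2 0
    rw [Finset.sum_eq_single (W.j (s + 0)) (fun i _ hi => by rw [hne i hi, zero_mul])
      (fun hi => absurd (Finset.mem_univ _) hi), direction_chart, mul_one] at hsum
    apply h.1
    funext i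
    by_cases hi : i = W.j (s + 0)
    · rw [hi]; exact hsum
    · exact hne i hi
  | succ m ih =>
    obtain ⟨i₀, hi₀, hne₀⟩ := ih
    have hkeep : carryLine W s c (m + 1) i₀ ≠ 0 := by
      rw [carryLine_succ_apply, if_neg hi₀]; exact hne₀
    by_contra hne
    push Not at hne
    have hsum := h.2 (m + 1)
    rw [Finset.sum_eq_single (W.j (s + (m + 1))) (fun i _ hi => by rw [hne i hi, zero_mul])
      (fun hi => absurd (Finset.mem_univ _) hi), direction_chart, mul_one] at hsum
    by_cases hi : i₀ = W.j (s + (m + 1))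
    · rw [hi] at hkeep; exact hkeep hsum
    · exact hkeep (hne i₀ hi)

/-- In `Fin 3`, two distinct indices leave exactly one third index. [folklore] -/
theorem Fin3.exists_third : ∀ a b : Fin 3, a ≠ b → ∃ m : Fin 3, m ≠ a ∧ m ≠ b ∧ ∀ i : Fin 3, i ≠ a → i ≠ b → i = m := by
  decide

/-- **THE CONTACT-LINE LAW (letters only).**  A carried contact line plus ONE chart change after it force a RESPECTED
COORDINATE PLANE: two moves with distinct charts zero two coefficients, the surviving functional is `c·u_m` for the
third index `m`, it never dies, and the contact equation then reads `δ_m = 0` at every later move — the walk never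
charts into `u_m` and never translates along `u_m` again (g19's PLANAR letter for `k = m`). [new] [folklore] -/
theorem planar_of_contactLine (W : ForcedWalk q s₀) {s : ℕ} {c : Fin 3 → K} (h : ContactLineFrom W s c)
    {n₀ : ℕ} (hchg : W.j (s + n₀ + 1) ≠ W.j (s + n₀)) :
    ∃ (k : Fin 3) (N' : ℕ), ∀ t, N' ≤ t → W.j t ≠ k ∧ W.b t k = 0 := by
  obtain ⟨m, hma, hmb, hthird⟩ := Fin3.exists_third (W.j (s + n₀)) (W.j (s + n₀ + 1)) hchg.symm
  -- from time `s + n₀ + 2` on, the coefficients at the two used charts vanish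
  have hza : ∀ n', n₀ + 1 ≤ n' → carryLine W s c n' (W.j (s + n₀)) = 0 :=
    carryLine_apply_eq_zero_of_le W s c (carryLine_chart_eq_zero W s c n₀)
  have hzb : ∀ n', n₀ + 2 ≤ n' → carryLine W s c n' (W.j (s + n₀ + 1)) = 0 := by
    have h1 := carryLine_chart_eq_zero W s c (n₀ + 1)
    rw [show s + (n₀ + 1) = s + n₀ + 1 from by ring] at h1
    exact carryLine_apply_eq_zero_of_le W s c h1
  refine ⟨m, s + n₀ + 2, fun t ht => ?_⟩
  obtain ⟨n', rfl⟩ : ∃ n', t = s + n' := ⟨t - s, by omega⟩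
  have hn' : n₀ + 2 ≤ n' := by omega
  -- the surviving coefficient sits at `m` and is non-zero
  obtain ⟨i₀, hi₀, hne₀⟩ := exists_ne_chart_carryLine_ne_zero W h n'
  have hi₀m : i₀ = m := by
    refine hthird i₀ (fun hh => hne₀ ?_) (fun hh => hne₀ ?_)
    · rw [hh]; exact hza n' (by omega)
    · rw [hh]; exact hzb n' hn'
  subst hi₀m
  -- the contact equation at time `s + n'` reads `c_m · δ_m = 0`
  have hsum := h.2 n'
  rw [Finset.sum_eq_single i₀ (fun i _ hi => ?_) (fun hi => absurd (Finset.mem_univ _) hi)] at hsum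
  · have hδ : direction W (s + n') i₀ = 0 := by
      rcases mul_eq_zero.mp hsum with h0 | h0
      · exact absurd h0 hne₀
      · exact h0
    refine ⟨fun hj => ?_, ?_⟩
    · rw [← hj, direction_chart] at hδ; exact one_ne_zero hδ
    · rw [direction_of_ne W (s + n') hi₀] at hδ; exact hδ
  · -- every other coefficient vanishes: `i` is one of the two used charts
    by_cases hia : i = W.j (s + n₀)
    · rw [hia, hza n' (by omega), zero_mul]
    · by_cases hib : i = W.j (s + n₀ + 1)
      · rw [hib, hzb n' hn', zero_mul]
      · exact absurd (hthird i hia hib) hi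

/-- Along a tail with infinitely many proximity repeats (chart changes) a contact line forces a planar tail. [folklore] -/
theorem planar_of_contactLine_of_repeats (W : ForcedWalk q s₀) {s : ℕ} {c : Fin 3 → K} (h : ContactLineFrom W s c)
    (hS : ∀ M : ℕ, ∃ t, M ≤ t ∧ StaysOnNewest W t) :
    ∃ (k : Fin 3) (N' : ℕ), ∀ t, N' ≤ t → W.j t ≠ k ∧ W.b t k = 0 := by
  obtain ⟨t, hst, hstay⟩ := hS s
  obtain ⟨n₀, rfl⟩ : ∃ n₀, t = s + n₀ := ⟨t - s, by omega⟩
  exact planar_of_contactLine W h (n₀ := n₀) hstay.1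

/-! ### §3c Clean moves along the walk: the tangent cone is transported verbatim -/

/-- **THE MOVE `t` IS CLEAN**: for every `μ_P`-minimiser `g₀` at `ifp W t` (order `d₀`) no higher homogeneous piece of
`g₀` interferes with the transported tangent cone (`CleanMove`).  Its negation, infinitely often, is the INTERFERENCE
leaf of NEXT-g21 (census: 85 of 1260 stalled pairs on the g18 beds). [new] -/
def CleanAt (W : ForcedWalk q s₀) (t : ℕ) : Prop :=
  ∀ J₀ ∈ (ifp W t).idx, (ifp W t).muP q = levelRatio (ordZero ((ifp W t).gen J₀)) (q - J₀.degree) →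
    ∀ d₀ : ℕ, ordZero ((ifp W t).gen J₀) = d₀ → CleanMove d₀ (W.j t) (W.b t) ((ifp W t).gen J₀)

/-- **Transport at a clean move of the walk**: the initial form of the minimiser at time `t + 1` is `u_j^{d₀ - a₀}` times
the degree-`n` part of the direction form at time `t` (`n` = the vertex order), for levels `a₀ ≤ d₀`. [folklore] -/
theorem initialForm_succ_of_cleanAt (W : ForcedWalk q s₀) (t : ℕ) (hc : CleanAt W t) {J₀ : Fin 3 →₀ ℕ}
    (hJ₀ : J₀ ∈ (ifp W t).idx) (hμ : (ifp W t).muP q = levelRatio (ordZero ((ifp W t).gen J₀)) (q - J₀.degree))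
    {d₀ : ℕ} (hd₀ : ordZero ((ifp W t).gen J₀) = d₀) (ha : q - J₀.degree ≤ d₀) {n : ℕ}
    (hn : ordZero (dirForm d₀ (W.j t) (W.b t) ((ifp W t).gen J₀)) = n) :
    ordZero ((ifp W (t + 1)).gen J₀) = ((d₀ - (q - J₀.degree) + n : ℕ) : ℕ∞) ∧
    homogeneousComponent (d₀ - (q - J₀.degree) + n) ((ifp W (t + 1)).gen J₀) =
      X (W.j t) ^ (d₀ - (q - J₀.degree)) * homogeneousComponent n (dirForm d₀ (W.j t) (W.b t) ((ifp W t).gen J₀)) := by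
  have hgen : (ifp W (t + 1)).gen J₀ =
      PointBlowup.translate (W.b t) (chartTransform (q - J₀.degree) (W.j t) ((ifp W t).gen J₀)) := by
    rw [ifp_succ]; rfl
  rw [hgen]
  exact ⟨ordZero_move_of_clean (W.b t) (W.onExc t) ha hd₀ hn (hc J₀ hJ₀ hμ d₀ hd₀),
    initialForm_move_of_clean (W.b t) (W.onExc t) ha hd₀ hn (hc J₀ hJ₀ hμ d₀ hd₀)⟩

end Walk

end Summit.ResolutionOfSingularities.ResolutionOfSingularities.Theorems.StallVertex
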